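import Summits.QuantumFields.YangMills.Theorems.BalabanUVNodesK0RecordFormatNamesLemmas5

/-!
# K0⁷ record FORMAT⁺ names — lemma file 6 (port-lead T-4a, J-rows part (i)): the decay-only receipts of names EDITION 12 READ ON NODE U3's
# OBJECTS `U3OfKernels.objects` ∕ the letters `U3KernelLetters` (generic term family), and the (1.21) letter of record ⟹ the run letters

DEFINER seat `ym-nodeO-def-1` (gen 34); port-lead LEDGER «T-4a PT-J generic rows over `U3OfKernels.objects` :284» (CRIT-1 Q-5: rows over the GENERIC
family are FREE).  Kernel-checked bookkeeping, nothing of Bałaban's asserted; `--kind proof --supports stmt-QuantumFields-20541 --as helper`; count-neutral.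

* §1 GENERIC BRIDGES (term family `fam`, chart `ρ`, basis `bV`):
  — DISCLOSURE ∕ ERRATUM E-DEF1-g34-3: EDITION 12's `PolLimitOnBoxOf F fam ρ bV γ` has the SAME BODY as node W1's `U3KernelLetters.PolLimitsExistBox F fam ρ bV γ`
    (2026-08-28); the bridge is `Iff.rfl` (`polLimitOnBoxOf_iff_polLimitsExistBox`) — cite the W1 name; the ed.12 one stays as a synonym (append-only tree).
  — `PolLimitsExist … (Window γ) ⟹ PolLimitOnBoxOf … γ` (W1's `.box`).
  — UNIFORM box decay ⟹ node U3's PER-SEQUENCE (5.10)-class binders at the pair `(0, 1)`: `PlimDecayOnBoxOf … γ C δ₁ ⟹ U3OfKernels.KernelDecay … (Window γ) 0 1 δ₁`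
    and `⟹ KernelDecayB … (Window γ) γ 0 1 δ₁`; finite volume: `PvolDecayEvOnBoxOf … γ C δ₁ ⟹ U3KernelLetters.WindowedDecay … (Window γ) 0 1 δ₁`
    (a window sequence's prefix is a box point; `kernelA g k = plimOf k (histPrefix g k)`, `pvolOf = polWindow`, both `rfl`).
  — box ⟹ runs at the record by the generic lemma: `PlimDecayOnBoxOf F (recordTerms[Ax] …) θ.ρ8 θ.bV γ C δ₁ ⟹ RecordPlimDecayOnRuns[Ax] … γ₀ C δ₁` (`γ₀ ≤ γ`).
* §2 THE (1.21) LETTER OF RECORD ⟹ THE RUN LETTERS: `PolLimitsExistOfRecord₁₃ F 2 (thetaFill F a₀ ε₂₉) ⟹ RecordPolLimitOnRuns F a₀ ε₂₉ γ₀` for `γ₀ ≤ ½`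
  (a run's prefix, padded by `T4FlagMemory.extd`, is a window sequence: `extd_mem_window`, `histPrefix_extd`); Ax twin from the generic window letter
  `U3KernelLetters.PolLimitsExist F (recordTermsAx …) θfill.ρ8 θfill.bV (Window ½)` (no `…OfRecord₁₃Ax` letter is declared in `Node00` at filing; the
  generic letter at `recordTermsAx` IS it).

HONEST FRAMING.  Helper lemmas (count-neutral); no port text is closed here; slot 8 `PortPiDecayUniformH` not yet born; stub 2′ OPEN; K0⁷ NOT closed (as vetted
choice-centred); NODE O not inhabited; the Π-holomorphic currency is print's unexecuted alternative (p.266) — record-facing texts read real-coupling decay only;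
finite 𝕋⁴ at fixed ε — not continuum ∕ OS ∕ Clay; the Yang–Mills mass gap is NOT proved by any of this.
-/

noncomputable section

open scoped BigOperators Matrix.Norms.L2Operator Topology
open Set Filter

namespace Summit.QuantumFields.YangMills.Theorems.K0RecordFormatNames

open Literature.MathematicalPhysics.QuantumFieldTheory.Balaban1983to89
open Literature.MathematicalPhysics.QuantumFieldTheory.Balaban1983to89.Node00
open Literature.MathematicalPhysics.QuantumFieldTheory.Balaban1983to89.T4Continuum (T4Family)
open Literature.MathematicalPhysics.QuantumFieldTheory.Balaban1983to89.FlowStep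
open Literature.MathematicalPhysics.QuantumFieldTheory.Balaban1983to89.T4OutputRate (Window mem_window)
open Literature.MathematicalPhysics.QuantumFieldTheory.Balaban1983to89.T4BetaReadOut (extd_mem_window)
open Literature.MathematicalPhysics.QuantumFieldTheory.Balaban1983to89.T4FlagMemory (extd)
open Literature.MathematicalPhysics.QuantumFieldTheory.Balaban1983to89.Node00.U3OfKernels (kernelA kernelB histPrefix KernelDecay KernelDecayB
  kernelDecayB_of_kernelDecay histPrefix_extd)
open Literature.MathematicalPhysics.QuantumFieldTheory.Balaban1983to89.Node00.U3KernelLetters (PolLimitsExist PolLimitsExistBox WindowedDecay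
  PolLimitsExistOfRecord₁₃)

/-! ## §0  `prefixOf = histPrefix` (a window sequence's prefix is a box point: `mem_box.2 fun i => hg i`, inlined below; as a named lemma it is the
N18 model file's `YMDAG.N18.FiniteVolumeLettersModel.histPrefix_mem_box`, not imported here to keep this file's cone small) -/

/-- `FlowStep.prefixOf` and `U3OfKernels.histPrefix` are the same function (`rfl`). [folklore] -/
theorem prefixOf_eq_histPrefix (g : ℕ → ℝ) (k : ℕ) : prefixOf g k = histPrefix g k := rfl

variable (F : T4Family)

/-! ## §1  GENERIC bridges: EDITION 12 ⟷ node U3's objects and letters -/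

section Generic

variable {𝔄 : Type*} [NormedRing 𝔄] [NormedAlgebra ℝ 𝔄]
variable {V : Type*} [NormedAddCommGroup V] [NormedSpace ℝ V] {ι : Type*} [Fintype ι]
variable (fam : TermFamily1 F 𝔄) (ρ : V →L[ℝ] 𝔄) (bV : Module.Basis ι ℝ V)

/-- **DISCLOSURE (E-DEF1-g34-3)**: EDITION 12's `PolLimitOnBoxOf` IS node W1's `U3KernelLetters.PolLimitsExistBox` (`Iff.rfl`; same body) — cite the W1 name.
[cite: Balaban1987RG1, (1.21) p.264 (bookkeeping)] -/
theorem polLimitOnBoxOf_iff_polLimitsExistBox (γ : ℝ) : PolLimitOnBoxOf F fam ρ bV γ ↔ PolLimitsExistBox F fam ρ bV γ := Iff.rfl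

/-- The WINDOW letter `PolLimitsExist … (Window γ)` gives the BOX letter (W1's `PolLimitsExist.box`). [cite: Balaban1987RG1, (1.21) p.264 (bookkeeping)] -/
theorem polLimitOnBoxOf_of_polLimitsExist {γ : ℝ} (h : PolLimitsExist F fam ρ bV (Window γ)) : PolLimitOnBoxOf F fam ρ bV γ := h.box

/-- **UNIFORM BOX DECAY ⟹ NODE U3's (5.10)-CLASS BINDER `KernelDecay` ON THE WINDOW at the pair `(0, 1)`** (one uniform constant serves every sequence;
`kernelA g k = plimOf k (histPrefix g k)` by `rfl`). [cite: Balaban1987RG1, (5.10) p.293, (1.21) p.264] -/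
theorem kernelDecay_of_plimDecayOnBoxOf {γ C δ₁ : ℝ} (h : PlimDecayOnBoxOf F fam ρ bV γ C δ₁) : KernelDecay F fam ρ bV (Window γ) 0 1 δ₁ :=
  fun g hg => ⟨C, fun k => h.2 k (histPrefix g k) (mem_box.2 fun i => hg i)⟩

/-- … hence node U3's run-B binder `KernelDecayB` on the window (`U3OfKernels.kernelDecayB_of_kernelDecay`). [cite: Balaban1987RG1, (5.10) p.293, Thm 1 p.259 (bookkeeping)] -/
theorem kernelDecayB_of_plimDecayOnBoxOf {γ C δ₁ : ℝ} (h : PlimDecayOnBoxOf F fam ρ bV γ C δ₁) : KernelDecayB F fam ρ bV (Window γ) γ 0 1 δ₁ :=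
  kernelDecayB_of_kernelDecay F fam ρ bV (kernelDecay_of_plimDecayOnBoxOf F fam ρ bV h)

/-- **UNIFORM FINITE-VOLUME BOX DECAY ⟹ W1's `WindowedDecay` ON THE WINDOW at `(0, 1)`** (`pvolOf … K μ ν z = polWindow F K (k+1) (fam k v K) ρ bV μ ν z`, `rfl`).
[cite: Balaban1987RG1, (5.10) p.293, (1.20) p.264] -/
theorem windowedDecay_of_pvolDecayEvOnBoxOf {γ C δ₁ : ℝ} (h : PvolDecayEvOnBoxOf F fam ρ bV γ C δ₁) : WindowedDecay F fam ρ bV (Window γ) 0 1 δ₁ :=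
  fun g hg => ⟨C, fun k z => h.2 k (histPrefix g k) (mem_box.2 fun i => hg i) z⟩

end Generic

/-! ## §2  At the record: box ⟹ runs by the generic lemma, and the (1.21) letter of record ⟹ the run letters -/

variable (a₀ ε₂₉ : ℝ)

/-- **Generic box decay at `recordTerms` ⟹ the record's run receipt** (`γ₀ ≤ γ`; `recordPlimDecayOnRuns_iff` + `plimDecayOnRunsOf_of_plimDecayOnBoxOf`).
[cite: Balaban1987RG1, (5.10) p.293, (0.20) p.256 (bookkeeping)] -/
theorem recordPlimDecayOnRuns_of_plimDecayOnBoxOf {γ γ₀ C δ₁ : ℝ} (hle : γ₀ ≤ γ)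
    (h : letI θ := thetaFill F a₀ ε₂₉
      letI := θ.instVβ₁; letI := θ.instVβ₂; letI := θ.instιβ
      PlimDecayOnBoxOf F (recordTerms F a₀ ε₂₉) θ.ρ8 θ.bV γ C δ₁) :
    RecordPlimDecayOnRuns F a₀ ε₂₉ γ₀ C δ₁ :=
  letI θ := thetaFill F a₀ ε₂₉
  letI := θ.instVβ₁; letI := θ.instVβ₂; letI := θ.instιβ
  (recordPlimDecayOnRuns_iff F a₀ ε₂₉ γ₀ C δ₁).2 (plimDecayOnRunsOf_of_plimDecayOnBoxOf F _ θ.ρ8 θ.bV h _ hle)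

/-- **… Ax twin** (`recordTermsAx`). [cite: Balaban1987RG1, (5.10) p.293, (0.20) p.256 (bookkeeping)] -/
theorem recordPlimDecayOnRunsAx_of_plimDecayOnBoxOf {γ γ₀ C δ₁ : ℝ} (hle : γ₀ ≤ γ)
    (h : letI θ := thetaFill F a₀ ε₂₉
      letI := θ.instVβ₁; letI := θ.instVβ₂; letI := θ.instιβ
      PlimDecayOnBoxOf F (recordTermsAx F a₀ ε₂₉) θ.ρ8 θ.bV γ C δ₁) :
    RecordPlimDecayOnRunsAx F a₀ ε₂₉ γ₀ C δ₁ :=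
  letI θ := thetaFill F a₀ ε₂₉
  letI := θ.instVβ₁; letI := θ.instVβ₂; letI := θ.instιβ
  (recordPlimDecayOnRunsAx_iff F a₀ ε₂₉ γ₀ C δ₁).2 (plimDecayOnRunsOf_of_plimDecayOnBoxOf F _ θ.ρ8 θ.bV h _ hle)

/-- **★ THE (1.21) LETTER OF RECORD ⟹ THE RUN LETTER** (bare; `γ₀ ≤ ½`): K0's existing proviso `PolLimitsExistOfRecord₁₃ F 2 (thetaFill F a₀ ε₂₉)` (window `]0, ½]^ℕ`)
gives `RecordPolLimitOnRuns F a₀ ε₂₉ γ₀` — a run's prefix lies in `Box γ₀ k ⊆ Box ½ k`, and padded by `extd` it is a window sequence whose `histPrefix` is the prefix.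
[cite: Balaban1987RG1, (1.21) p.264, (0.20) p.256 (bookkeeping)] -/
theorem recordPolLimitOnRuns_of_polLimitsExistOfRecord₁₃ {γ₀ : ℝ} (hγh : γ₀ ≤ 1 / 2)
    (h : PolLimitsExistOfRecord₁₃ F 2 (thetaFill F a₀ ε₂₉)) : RecordPolLimitOnRuns F a₀ ε₂₉ γ₀ := by
  intro n gs _ hI k hk
  have hv : prefixOf gs k ∈ Box (1 / 2) k := box_mono hγh (prefixOf_mem_box_of_inInterval hI hk)
  have h' := (polLimitsExistOfRecord₁₃_thetaFill_iff F a₀ ε₂₉).1 h (extd (prefixOf gs k)) (extd_mem_window hv) k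
  simpa only [histPrefix_extd] using h'

/-- **★ … Ax twin from the GENERIC window letter at `recordTermsAx`** (`U3KernelLetters.PolLimitsExist F (recordTermsAx …) θfill.ρ8 θfill.bV (Window ½)`).
[cite: Balaban1987RG1, (1.21) p.264, (0.20) p.256 (bookkeeping)] -/
theorem recordPolLimitOnRunsAx_of_polLimitsExist {γ₀ : ℝ} (hγh : γ₀ ≤ 1 / 2)
    (h : letI θ := thetaFill F a₀ ε₂₉
      letI := θ.instVβ₁; letI := θ.instVβ₂; letI := θ.instιβ
      PolLimitsExist F (recordTermsAx F a₀ ε₂₉) θ.ρ8 θ.bV (Window (1 / 2))) :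
    RecordPolLimitOnRunsAx F a₀ ε₂₉ γ₀ := by
  intro n gs _ hI k hk
  have hv : prefixOf gs k ∈ Box (1 / 2) k := box_mono hγh (prefixOf_mem_box_of_inInterval hI hk)
  have h' := h (extd (prefixOf gs k)) (extd_mem_window hv) k
  simpa only [histPrefix_extd] using h'

end Summit.QuantumFields.YangMills.Theorems.K0RecordFormatNames

end
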